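/-
Origin: expansion seat `prover-pub-hodgecm-mc-sinst-1-g10-0`, handover #1250 2026-08-20T23:05Z md5 2f122218d60d (132 l.; NEW additive leaf, ns HodgeCM.Model.ThetaAdelicSide: archLineInput_Φinf_ne_zero, thetaDistDatumZeroOf, thetaDistDatumOneOf (two `def`s = terms of the #1246 structure ThetaDistDatum at archSideOf …, slots 0/1); NAMES for audit: HodgeCM.Model.ThetaAdelicSide.archLineInput_Φinf_ne_zero · HodgeCM.Model.ThetaDistFin.finRepOne_smooth · HodgeCM.Model.ThetaDistFin.lineRepOf_one_finToG_eq_adelicTensorEnd) (`HOME/mc/pub-hodgecm-mc-sinst-1-g10/stage66/HodgeCM/Model/AdelicThetaDistributionOf.lean`, md5 2f122218d60d, 132 lines);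
landed by the second packager p2 gen 15 (p2-g15) in gate run 66 as `HodgeCM/Model/AdelicThetaDistributionOf.lean` (verbatim).
-/
/-
Copyright (c) 2026 the pub-hodgecm formalisation cell (harness21).  New file, not vendored.
Origin: session prover-pub-hodgecm-mc-sinst-1-g10-0 (unit pub-hodgecm-mc-sinst-1-g10, S-INSTANCE CONSTRUCTOR gen 10; the HONEST INSTANCE of the (J4)
product Weil datum at period-1's S pin term `archSideOf …`, slots 0 and 1), 2026-08-20.
Intended final place: `HodgeCM/Model/AdelicThetaDistributionOf.lean` (NEW additive model-layer leaf; imports sinst-1's `Model/AdelicThetaDistribution`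
(#1246) and `Model/AdelicThetaDistributionFin`, carch's `Model/ArchKTypeOfOmega`, period-1's `Model/ArchSideOf`; nothing imports it; drop alone).
-/
import Summits.HodgeConjecture.HodgeCM.Model.AdelicThetaDistribution
import Summits.HodgeConjecture.HodgeCM.Model.AdelicThetaDistributionFin_2
import Summits.HodgeConjecture.HodgeCM.Model.ArchKTypeOfOmega
import Summits.HodgeConjecture.HodgeCM.Model.ArchSideOf_2

set_option autoImplicit false

/-!
# The honest (J4) product Weil datum of `archSideOf …`, slots 0 and 1

`ThetaAdelicSide.ThetaDistDatum (archSideOf V c hGR hGR₀ hGR₁ hGR₂ hGR₃ η hη hηc h₁W A) hV k`, k = 0, 1, ASSEMBLED: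
* `ωA := lineOmega_zero/one …` and `hA := lineRepOf_zero/one_archInfOf_eq …` (carch `Model/ArchKTypeOfOmega`; `(P k).ω = lineRepOf … k` and
  `ιinf = archInfOf V` hold by `rfl` at the term);
* the FINITE half `Uf / toIdele / ωf / fin_V / fin_W / smooth` from `Model/AdelicThetaDistributionFin` (`finRepZero/One`,
  `lineRepOf_k_finToG_eq_adelicTensorEnd`, `lineRepOf_k_one_finLineTorusIdeles_eq_adelicTensorEnd`, `finRep_k_smooth` with the nonzero archimedean
  vector `(A k).Φinf`, nonzero by `(A k).hx₀`);
* the ARCHIMEDEAN family `Φarch` with `harm` / `hdef` is taken as INPUT in exactly the currency carch #CA61 `Model/ArchKTypeOfDist` delivers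
  (`Φarch := blockFamilyOfAt … eR eS (degOnePDual Empty) (binvPi 1)`, `harm := harm_lineOmega_zeroG …`, `hdef := harch_zero_of_defType_tmulG …`),
  so that this file stays free of the pin's sign / exponent bookkeeping (`hemb`, `hpos`, `hχ`, `defExponent`), which glue-1 reads off E's guard.
Consequence (with #1247/#1248): for every finite test vector `Φ_f` and every character `χ` with `charInv χ` a weight function, the tower class of
`θ(Φarch(·) ⊗ Φ_f, charInv χ)` of slots 0/1 of the HONEST adelic side lies in the block of the slot's Liu module `Ω(χ)` — `hfam` clause 2 for the
product-type theta forms, kernel-checked at the constructed model.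
KERNEL only: two `def`s (terms of an existing structure) + read-back lemmas; 0 records, 0 `def … : Prop`, nothing cited.
-/

noncomputable section

open NumberField NumberField.mixedEmbedding IsDedekindDomain MulAction
open scoped Matrix TensorProduct Classical SchwartzMap
open Literature.NumberTheory.Automorphic Literature.NumberTheory.Weil1964
open Literature.NumberTheory.GelbartRogawski1991 Literature.NumberTheory.GelbartRogawski1991.UnitaryDualPair
open Literature.Geometry.ComplexHyperbolic.BallModel (U21 x₀)
open Literature.AlgebraicGeometry.ShimuraVarieties
open HodgeCM.Adelic HodgeCM.PerL34 HodgeCM.Model.ArchSideTerm HodgeCM.Model.ThetaDistFin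

namespace HodgeCM.Model
namespace ThetaAdelicSide

variable {L : CMField} {ι₁ : L →+* ℂ} (V : HermSpace3 L ι₁) (c : SeesawCtx L)
  (hGR : (cmSplittingDatum (L : Type) finProdFinEquiv (frameD V) (frameD_real V) (frameD_ne V) (dW c.D) (dW_real c.D)
    (dW_ne c.D)).CompatibleSplitting)
  (hGR₀ : (cmSplittingDatum (L : Type) (e₁) (frameD V) (frameD_real V) (frameD_ne V) (lineVec (L : Type) (dW c.D 0))
    (fun _ => dW_real c.D 0) (fun _ => dW_ne c.D 0)).CompatibleSplitting)
  (hGR₁ : (cmSplittingDatum (L : Type) (e₁) (frameD V) (frameD_real V) (frameD_ne V) (lineVec (L : Type) (dW c.D 1))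
    (fun _ => dW_real c.D 1) (fun _ => dW_ne c.D 1)).CompatibleSplitting)
  (hGR₂ : (cmSplittingDatum (L : Type) (e₁) (frameD V) (frameD_real V) (frameD_ne V) (lineVec (L : Type) (dW' c.D 0))
    (fun _ => dW'_real c.D 0) (fun _ => dW'_ne c.D 0)).CompatibleSplitting)
  (hGR₃ : (cmSplittingDatum (L : Type) (e₁) (frameD V) (frameD_real V) (frameD_ne V) (lineVec (L : Type) (dW' c.D 1))
    (fun _ => dW'_real c.D 1) (fun _ => dW'_ne c.D 1)).CompatibleSplitting)
  (η : CMAdelic (L : Type) (frameD V) × CMAdelic (L : Type) (dW c.D) →* ℂˣ)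
  (hη : ∀ γU ∈ CMRat (L : Type) (frameD V), ∀ γ ∈ CMRat (L : Type) (dW c.D), η (γU, γ) = 1)
  (hηc : Continuous fun p => ((η p : ℂˣ) : ℂ))
  (h₁W : (∀ j, 0 < (ι₁ (dW c.D j)).re) ∨ ∀ j, (ι₁ (dW c.D j)).re < 0)
  (A : ∀ k : Fin 4, ArchLineInput V (lineRepD V c.D hGR hGR₀ hGR₁ hGR₂ hGR₃ η k))
  (hV : IsAnisotropic L V.Hm)

/-- the archimedean test function of a line input is nonzero (`φ_∞(x₀) ≠ 0`). -/
theorem archLineInput_Φinf_ne_zero (k : Fin 4) : (A k).Φinf ≠ 0 := fun h =>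
  (A k).hx₀ (by rw [h]; rfl)

/-- **THE HONEST (J4) PRODUCT WEIL DATUM OF SLOT 0** at `archSideOf …`, given the harmonic family `Φarch` with its `harm` (under `lineOmega_zero`)
and `hdef` ((c5) for every finite vector) in carch's #CA61 currency. -/
def thetaDistDatumZeroOf (Φarch : Module.Dual ℂ (Fin 2 → ℂ) →ₗ[ℂ] 𝓢((Fin 3 → mixedSpace (↥(maximalRealSubfield L))), ℂ))
    (harm : ∀ (u : ↥(stabilizer U21 x₀)) (ℓ : Module.Dual ℂ (Fin 2 → ℂ)),
      lineOmega_zero V c.D hGR hGR₀ hGR₁ (eta₀ V c.D η) (u : U21) (Φarch ℓ) =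
        Φarch ((BallForms.isPullbackCocycle_cotangentCocycle.weightOf x₀).dual u ℓ))
    (hdef : ∀ a : UnitaryGroup.arch (↥(maximalRealSubfield L)) L (IsCMField.complexConj L) 3 V.Hm,
      UnitaryGroup.archAt (↥(maximalRealSubfield L)) L (IsCMField.complexConj L) 3 V.Hm (UnitaryGroup.cmPlace (L : Type) ι₁)
          (NumberField.complexConj_smul_infinitePlace (L : Type) _) (IsCMField.complexConj_ne_one (L : Type)) a = 1 →
      ∀ (ℓ : Module.Dual ℂ (Fin 2 → ℂ)) (Φf : FinSB (↥(maximalRealSubfield L)) (Fin 3)),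
        lineRepOf V c.D hGR hGR₀ hGR₁ hGR₂ hGR₃ (eta₀ V c.D η) (eta₁ V c.D η) (eta₂ V c.D η) (eta₃ V c.D η) 0
            (HodgeCM.Adelic.regimeEquiv L V.Hm hV
              (UnitaryGroup.archToAdelic (↥(maximalRealSubfield L)) L (IsCMField.complexConj L) 3 V.Hm a), 1)
            (piSchwartzBruhatEquiv (↥(maximalRealSubfield L)) (Fin 3) (Φarch ℓ ⊗ₜ[ℂ] Φf)) =
          piSchwartzBruhatEquiv (↥(maximalRealSubfield L)) (Fin 3) (Φarch ℓ ⊗ₜ[ℂ] Φf)) :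
    ThetaDistDatum (archSideOf V c hGR hGR₀ hGR₁ hGR₂ hGR₃ η hη hηc h₁W A) hV 0 where
  ωA := lineOmega_zero V c.D hGR hGR₀ hGR₁ (eta₀ V c.D η)
  hA g := lineRepOf_zero_archInfOf_eq V c.D hGR hGR₀ hGR₁ hGR₂ hGR₃ (eta₀ V c.D η) (eta₁ V c.D η) (eta₂ V c.D η) (eta₃ V c.D η) hV g
  Φarch := Φarch
  harm := harm
  hdef := hdef
  Uf := UfZero c.D
  toIdele := finLineTorusIdeles (L : Type) (dW c.D 0) (dW_ne c.D 0)
  ωf := finRepZero V c.D hGR hGR₀ hGR₁ (eta₀ V c.D η)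
  fin_V g := lineRepOf_zero_finToG_eq_adelicTensorEnd V c.D hGR hGR₀ hGR₁ hGR₂ hGR₃ (eta₀ V c.D η) (eta₁ V c.D η) (eta₂ V c.D η)
    (eta₃ V c.D η) hV g
  fin_W u := lineRepOf_zero_one_finLineTorusIdeles_eq_adelicTensorEnd V c.D hGR hGR₀ hGR₁ hGR₂ hGR₃ (eta₀ V c.D η) (eta₁ V c.D η)
    (eta₂ V c.D η) (eta₃ V c.D η) u
  smooth Φf := finRepZero_smooth V c.D hGR hGR₀ hGR₁ (eta₀ V c.D η)
    (continuous_cmEta₀ (L : Type) (frameD V) (dW c.D) η hηc) h₁W (archLineInput_Φinf_ne_zero V c hGR hGR₀ hGR₁ hGR₂ hGR₃ η A 0) Φf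

/-- **THE HONEST (J4) PRODUCT WEIL DATUM OF SLOT 1** at `archSideOf …`. -/
def thetaDistDatumOneOf (Φarch : Module.Dual ℂ (Fin 2 → ℂ) →ₗ[ℂ] 𝓢((Fin 3 → mixedSpace (↥(maximalRealSubfield L))), ℂ))
    (harm : ∀ (u : ↥(stabilizer U21 x₀)) (ℓ : Module.Dual ℂ (Fin 2 → ℂ)),
      lineOmega_one V c.D hGR hGR₀ hGR₁ (eta₁ V c.D η) (u : U21) (Φarch ℓ) =
        Φarch ((BallForms.isPullbackCocycle_cotangentCocycle.weightOf x₀).dual u ℓ))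
    (hdef : ∀ a : UnitaryGroup.arch (↥(maximalRealSubfield L)) L (IsCMField.complexConj L) 3 V.Hm,
      UnitaryGroup.archAt (↥(maximalRealSubfield L)) L (IsCMField.complexConj L) 3 V.Hm (UnitaryGroup.cmPlace (L : Type) ι₁)
          (NumberField.complexConj_smul_infinitePlace (L : Type) _) (IsCMField.complexConj_ne_one (L : Type)) a = 1 →
      ∀ (ℓ : Module.Dual ℂ (Fin 2 → ℂ)) (Φf : FinSB (↥(maximalRealSubfield L)) (Fin 3)),
        lineRepOf V c.D hGR hGR₀ hGR₁ hGR₂ hGR₃ (eta₀ V c.D η) (eta₁ V c.D η) (eta₂ V c.D η) (eta₃ V c.D η) 1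
            (HodgeCM.Adelic.regimeEquiv L V.Hm hV
              (UnitaryGroup.archToAdelic (↥(maximalRealSubfield L)) L (IsCMField.complexConj L) 3 V.Hm a), 1)
            (piSchwartzBruhatEquiv (↥(maximalRealSubfield L)) (Fin 3) (Φarch ℓ ⊗ₜ[ℂ] Φf)) =
          piSchwartzBruhatEquiv (↥(maximalRealSubfield L)) (Fin 3) (Φarch ℓ ⊗ₜ[ℂ] Φf)) :
    ThetaDistDatum (archSideOf V c hGR hGR₀ hGR₁ hGR₂ hGR₃ η hη hηc h₁W A) hV 1 where
  ωA := lineOmega_one V c.D hGR hGR₀ hGR₁ (eta₁ V c.D η)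
  hA g := lineRepOf_one_archInfOf_eq V c.D hGR hGR₀ hGR₁ hGR₂ hGR₃ (eta₀ V c.D η) (eta₁ V c.D η) (eta₂ V c.D η) (eta₃ V c.D η) hV g
  Φarch := Φarch
  harm := harm
  hdef := hdef
  Uf := UfOne c.D
  toIdele := finLineTorusIdeles (L : Type) (dW c.D 1) (dW_ne c.D 1)
  ωf := finRepOne V c.D hGR hGR₀ hGR₁ (eta₁ V c.D η)
  fin_V g := lineRepOf_one_finToG_eq_adelicTensorEnd V c.D hGR hGR₀ hGR₁ hGR₂ hGR₃ (eta₀ V c.D η) (eta₁ V c.D η) (eta₂ V c.D η)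
    (eta₃ V c.D η) hV g
  fin_W u := lineRepOf_one_one_finLineTorusIdeles_eq_adelicTensorEnd V c.D hGR hGR₀ hGR₁ hGR₂ hGR₃ (eta₀ V c.D η) (eta₁ V c.D η)
    (eta₂ V c.D η) (eta₃ V c.D η) u
  smooth Φf := finRepOne_smooth V c.D hGR hGR₀ hGR₁ (eta₁ V c.D η)
    (continuous_cmEta₁_comp_snd (L : Type) (frameD V) (dW c.D) η hηc) (archLineInput_Φinf_ne_zero V c hGR hGR₀ hGR₁ hGR₂ hGR₃ η A 1) Φf

end ThetaAdelicSide
end HodgeCM.Model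

end
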